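import Literature.Analysis.UnboundedOperators.HeatKernel
import Mathlib.Topology.MetricSpace.Bounded
import Mathlib.Analysis.Normed.Group.Bounded
import HarnessLib

/-!
# The caloric extension of bounded data vanishing at infinity vanishes at infinity

Analysis/FluidPDE support file (everything proved; no definitions, no named facts).  On a
finite-dimensional real inner product space `E` the heat semigroup `e^{τΔ}` preserves the class
`C₀` of (bounded, measurable) data tending to `0` at infinity: if `‖g‖ ≤ C`, `g → 0` along
`cocompact E` and `τ > 0`, then `e^{τΔ}g → 0` along `cocompact E`
(`tendsto_heatExtension_cocompact`).  The Gaussian mass outside a large ball `B(0, R₁)` is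
small, and on `B(0, R₁)` the translated data `g(x − y)` is small once `‖x‖ ≥ R₀ + R₁`
(Engel–Nagel 2000, Ch. II, 2.13: the Gaussian semigroup is strongly continuous on `C₀(ℝⁿ)`;
the template is the tree's horizontal-decay statement
`exists_forall_norm_heatExtension_le_of_cylRadius`, `KNSSMildDecayHorizontal.lean`).  Two
elementary reformulations of "`g → 0` at infinity" on a proper space by norms are included
(`tendsto_cocompact_nhds_zero_iff_norm`, `exists_bound_of_tendsto_cocompact_nhds_zero`).

## Mathlib / tree search

Tree: `UnboundedOperators.heatExtension_apply`, `integrable_heatKernel_holds`,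
`integral_heatKernel_eq_one_holds`, `heatKernel_pos`, `continuous_heatKernel`
(`HeatKernel.lean`); `tendsto_setIntegral_norm_ge_atTop`,
`exists_forall_norm_heatExtension_le_of_cylRadius` (`KNSSMildDecayHorizontal.lean`, cylindrical
version, not imported). Mathlib: `Metric.cobounded_eq_cocompact`,
`Metric.hasBasis_cobounded_compl_closedBall`, `tendsto_setIntegral_of_antitone`,
`IsCompact.exists_bound_of_continuousOn`.

## References

* K.-J. Engel, R. Nagel, *One-Parameter Semigroups for Linear Evolution Equations*, Springer
  2000, Ch. II, 2.13 (the diffusion semigroup on `C₀(ℝⁿ)`). [folklore]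
-/

noncomputable section

open MeasureTheory Set Function Filter Metric
open _root_.Topology

namespace Literature.Analysis.FluidPDE

section Cocompact

variable {X : Type*} [SeminormedAddCommGroup X] [ProperSpace X]
variable {F : Type*} [SeminormedAddCommGroup F]

/-- On a proper normed group, `g → 0` along `cocompact` iff `‖g x‖ ≤ ε` for `‖x‖` large, for
every `ε > 0` (complements of closed balls form a basis of `cocompact = cobounded`). [folklore] -/
theorem tendsto_cocompact_nhds_zero_iff_norm {g : X → F} :
    Tendsto g (cocompact X) (𝓝 0) ↔ ∀ ε : ℝ, 0 < ε → ∃ A : ℝ, ∀ x, A ≤ ‖x‖ → ‖g x‖ ≤ ε := by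
  rw [← Metric.cobounded_eq_cocompact,
    (Metric.hasBasis_cobounded_compl_closedBall (0 : X)).tendsto_iff Metric.nhds_basis_closedBall]
  constructor
  · intro h ε hε
    obtain ⟨A, -, hA⟩ := h ε hε
    refine ⟨A + 1, fun x hx => ?_⟩
    have hx' : x ∈ (closedBall (0 : X) A)ᶜ := by
      rw [mem_compl_iff, mem_closedBall_zero_iff, not_le]; linarith
    simpa [dist_zero_right] using hA x hx'
  · intro h ε hε
    obtain ⟨A, hA⟩ := h ε hε
    refine ⟨A, trivial, fun x hx => ?_⟩
    rw [mem_compl_iff, mem_closedBall_zero_iff, not_le] at hx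
    simpa [dist_zero_right] using hA x hx.le

/-- A continuous field tending to `0` at infinity on a proper normed group is bounded. [folklore] -/
theorem exists_bound_of_tendsto_cocompact_nhds_zero {g : X → F} (hg : Continuous g)
    (h0 : Tendsto g (cocompact X) (𝓝 0)) : ∃ C : ℝ, 0 ≤ C ∧ ∀ x, ‖g x‖ ≤ C := by
  obtain ⟨A, hA⟩ := tendsto_cocompact_nhds_zero_iff_norm.1 h0 1 one_pos
  obtain ⟨B, hB⟩ := (isCompact_closedBall (0 : X) A).exists_bound_of_continuousOn hg.continuousOn
  refine ⟨max B 1, le_max_of_le_right zero_le_one, fun x => ?_⟩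
  by_cases hx : ‖x‖ ≤ A
  · exact (hB x (mem_closedBall_zero_iff.2 hx)).trans (le_max_left _ _)
  · exact (hA x (not_le.1 hx).le).trans (le_max_right _ _)

end Cocompact

section Heat

variable {E : Type*} [NormedAddCommGroup E] [InnerProductSpace ℝ E] [FiniteDimensional ℝ E]
  [MeasurableSpace E] [BorelSpace E]
variable {F : Type*} [NormedAddCommGroup F] [NormedSpace ℝ F]

-- adapted from KNSSMildDecayHorizontal.lean (`tendsto_setIntegral_norm_ge_atTop`,
-- `exists_forall_norm_heatExtension_le_of_cylRadius`)

/-- **The caloric extension of bounded data vanishing at infinity is small far away**: if `g` is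
measurable, `‖g‖ ≤ C`, and `‖g z‖ ≤ ε` for `‖z‖` large (every `ε > 0`), then for `τ > 0` and
`ε > 0` there is `A` with `‖e^{τΔ}g(x)‖ ≤ ε` whenever `A ≤ ‖x‖`: the Gaussian mass outside
`B(0, R₁)` is small and on `B(0, R₁)` the data `g(x − y)` is small, `‖x − y‖ ≥ ‖x‖ − ‖y‖`
(Engel–Nagel 2000, II.2.13). [folklore] -/
theorem exists_forall_norm_heatExtension_le_of_norm {g : E → F}
    (hgm : AEStronglyMeasurable g volume) {C : ℝ} (hC : ∀ z, ‖g z‖ ≤ C)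
    (hdec : ∀ ε : ℝ, 0 < ε → ∃ R : ℝ, ∀ z, R ≤ ‖z‖ → ‖g z‖ ≤ ε) {τ : ℝ} (hτ : 0 < τ) {ε : ℝ}
    (hε : 0 < ε) :
    ∃ A : ℝ, ∀ x, A ≤ ‖x‖ → ‖UnboundedOperators.heatExtension g τ x‖ ≤ ε := by
  have hC0 : 0 ≤ C := (norm_nonneg _).trans (hC 0)
  set G : E → ℝ := UnboundedOperators.heatKernel τ with hG
  have hGi : Integrable G volume := UnboundedOperators.integrable_heatKernel_holds hτ
  have hG0 : ∀ y, 0 ≤ G y := fun y => (UnboundedOperators.heatKernel_pos hτ y).le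
  have hsm : ∀ R : ℝ, MeasurableSet {z : E | R ≤ ‖z‖} := fun R =>
    (isClosed_le continuous_const continuous_norm).measurableSet
  -- the Gaussian tail `∫_{R ≤ ‖z‖} G → 0`
  have htail : Tendsto (fun R : ℝ => ∫ z in {z : E | R ≤ ‖z‖}, G z) atTop (𝓝 0) := by
    have hanti : Antitone fun R : ℝ => {z : E | R ≤ ‖z‖} := fun R R' h z hz => le_trans h hz
    have h := tendsto_setIntegral_of_antitone (μ := volume) hsm hanti ⟨0, hGi.integrableOn⟩
    have hempty : (⋂ R : ℝ, {z : E | R ≤ ‖z‖}) = ∅ := by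
      ext z
      simp only [mem_iInter, mem_setOf_eq, mem_empty_iff_false, iff_false, not_forall, not_le]
      exact ⟨‖z‖ + 1, by linarith⟩
    rw [hempty, Measure.restrict_empty, integral_zero_measure] at h
    exact h
  set η : ℝ := ε / 2 / (C + 1) with hη
  have hη0 : 0 < η := by positivity
  obtain ⟨R₁, hR₁⟩ := (htail.eventually (gt_mem_nhds hη0)).exists_forall_of_atTop
  obtain ⟨R₀, hR₀⟩ := hdec (ε / 2) (by positivity)
  refine ⟨R₀ + R₁, fun x hx => ?_⟩
  -- the convolution integrand is integrable
  have hint : Integrable (fun y => G y • g (x - y)) volume := by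
    have hm : AEStronglyMeasurable (fun y => G y • g (x - y)) volume :=
      (UnboundedOperators.continuous_heatKernel τ).aestronglyMeasurable.smul
        (hgm.comp_measurePreserving (Measure.measurePreserving_sub_left volume x))
    refine ((hGi.norm).mul_const C).mono' hm (Eventually.of_forall fun y => ?_)
    rw [norm_smul]
    exact mul_le_mul_of_nonneg_left (hC _) (norm_nonneg _)
  -- pointwise majorant
  have hpt : ∀ y, ‖G y • g (x - y)‖ ≤
      G y * (ε / 2) + C * ({y : E | R₁ ≤ ‖y‖}.indicator G y) := by
    intro y
    rw [norm_smul, Real.norm_of_nonneg (hG0 y)]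
    by_cases hy : R₁ ≤ ‖y‖
    · rw [indicator_of_mem (show y ∈ {y : E | R₁ ≤ ‖y‖} from hy)]
      have h1 : G y * ‖g (x - y)‖ ≤ G y * C := mul_le_mul_of_nonneg_left (hC _) (hG0 y)
      have h2 : 0 ≤ G y * (ε / 2) := mul_nonneg (hG0 y) (by positivity)
      nlinarith
    · rw [indicator_of_notMem (show y ∉ {y : E | R₁ ≤ ‖y‖} from hy), mul_zero, add_zero]
      refine mul_le_mul_of_nonneg_left (hR₀ _ ?_) (hG0 y)
      have h1 := norm_sub_norm_le x y
      linarith [not_le.1 hy]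
  have hint1 : Integrable (fun y => G y * (ε / 2)) volume := hGi.mul_const _
  have hint2 : Integrable (fun y => C * ({y : E | R₁ ≤ ‖y‖}.indicator G y)) volume :=
    (hGi.indicator (hsm R₁)).const_mul C
  rw [UnboundedOperators.heatExtension_apply]
  calc ‖∫ y, G y • g (x - y)‖ ≤ ∫ y, ‖G y • g (x - y)‖ := norm_integral_le_integral_norm _
    _ ≤ ∫ y, (G y * (ε / 2) + C * ({y : E | R₁ ≤ ‖y‖}.indicator G y)) :=
        integral_mono hint.norm (hint1.add hint2) hpt
    _ = (∫ y, G y) * (ε / 2) + C * ∫ y in {y : E | R₁ ≤ ‖y‖}, G y := by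
        rw [integral_add hint1 hint2, integral_mul_const, integral_const_mul,
          integral_indicator (hsm R₁)]
    _ ≤ 1 * (ε / 2) + C * η := by
        have h1 : ∫ y, G y = 1 := UnboundedOperators.integral_heatKernel_eq_one_holds hτ
        have h2 : ∫ y in {y : E | R₁ ≤ ‖y‖}, G y ≤ η := (hR₁ R₁ le_rfl).le
        rw [h1]
        gcongr
    _ ≤ ε := by
        rw [hη, one_mul]
        have : C * (ε / 2 / (C + 1)) = ε / 2 * (C / (C + 1)) := by ring
        rw [this]
        have hc : C / (C + 1) ≤ 1 := by rw [div_le_one (by positivity)]; linarith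
        nlinarith

/-- **The heat semigroup preserves `C₀`**: for measurable data `g` with `‖g‖ ≤ C` and `g → 0`
along `cocompact E`, and `τ > 0`, the caloric extension `e^{τΔ}g` tends to `0` along
`cocompact E` (Engel–Nagel 2000, II.2.13). [folklore] -/
theorem tendsto_heatExtension_cocompact {g : E → F} (hgm : AEStronglyMeasurable g volume)
    {C : ℝ} (hC : ∀ z, ‖g z‖ ≤ C) (h0 : Tendsto g (cocompact E) (𝓝 0)) {τ : ℝ} (hτ : 0 < τ) :
    Tendsto (UnboundedOperators.heatExtension g τ) (cocompact E) (𝓝 0) :=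
  tendsto_cocompact_nhds_zero_iff_norm.2 fun _ hε =>
    exists_forall_norm_heatExtension_le_of_norm hgm hC (tendsto_cocompact_nhds_zero_iff_norm.1 h0)
      hτ hε

end Heat

end Literature.Analysis.FluidPDE

end
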